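import Literature.AnabelianGeometry.SemiGraphs.ArithBranchActionConsequences
import HarnessLib

/-!
# [SemiAnbd] §5 p. 65 / Def 5.3 (iii): the edge-like subgroups of the PRODUCED decomposition data do
# not depend on the chosen §3 representatives — over the chart action, WITHOUT "no switching of branches"

Mochizuki, *Semi-graphs of anabelioids*, Publ. RIMS **42** (2006) 221–322, §5 p. 65 ("`Π^temp_{𝔊,v}`,
`Π^temp_{𝔊,b} ⊆ Π^temp_{𝔊,v}` … well-defined up to conjugation in `Π^temp_𝔊` … the commensurator in
`Π^temp_{𝔊,v}` of `Π^temp_{𝔾,b}`"), Def 5.3 (iii) p. 65 (edge-like subgroups: those "of the form `Π^temp_{𝔊,b}`"),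
Def 5.1 (i) p. 62 (the arithmetic action on the underlying semi-graph), Thm 3.7 (iii) pp. 40–41 ("contained
in precisely two verticial subgroups"). [cite: MochizukiSemiAnbd2006, §5, p. 65]

PROOF-ONLY companion (abc-iut cell, layer L3, sub-DAG `plan/L3/SUBDAG-SemiAnbd-Thm54.md`; row
«T54·Rc-INVARIANCE», EDGE half, second file; seat abc-iut-w4-d089 gen 7).  No definition, no new named fact.
The first file (`ArithBrGpOfCommensuratorGrowth.lean`) proved that the edge-like notion of
`decompositionDataOfChart R ι` (abc-iut-w4-d053) is independent of `R : ChartRepresentatives c` under the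
menu input (H-CE) "commensurator growth", i.e. in the regime where the arithmetic action does not switch the
branches of any edge.  Here the same independence is proved WITHOUT (H-CE) and without "no switching", over
the PARENT package `ArithChartAction` (abc-iut-w4-d029/d053: conjugation by `Π^temp_𝔊` carries verticial,
resp. edge-like, subgroups to verticial, resp. edge-like, subgroups through `ι`), from Thm 3.7 (iii) at `𝒢`
(`CompactInVerticialAt 𝒢` — a theorem for finite `𝔾`) and the rigidity of edge-like subgroups
(`TemperedEdgeLikeCommensurator.lean`):

* `ArithChartAction.conjSubgroup_map_eq_of_mem_commensurator` — an element of `Π^temp_𝔊` commensurating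
  `ι Π^temp_{𝔾,e}` NORMALISES it (commensurable edge-like subgroups are equal);
* `ArithChartAction.exists_conj_commensurator_inf_eq` — the FLAG LEMMA: for an edge-like `L` and two verticial
  hosts `H ⊇ L`, `H' ⊇ L` (at any vertices), the "flags" `C(ι H) ⊓ C(ι L)` and `C(ι H') ⊓ C(ι L)` are conjugate by
  an element of `C(ι L)`.  Proof: if `H ≠ H'` these are the ONLY two verticial hosts of `L` (Thm 3.7 (iii),
  "precisely two"); every `g ∈ C(ι L)` normalises `ι L` and carries `ι H` to `ι` of a verticial host of `L`, so
  `C(ι L)` permutes `{ι H, ι H'}`; either some `g` swaps them — then it conjugates one flag onto the other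
  (the "branch switching" case) — or all of `C(ι L)` normalises `ι H` and `ι H'`, whence both flags equal
  `C(ι L)` (the "no switching" case);
* `ArithChartAction.exists_commensurator_inf_eq_conjSubgroup_arithBrGp` — hence for a branch `b` at `v`, EVERY
  pair (edge-like `L` of `e(b)`, verticial host `H ⊇ L` at `v`) gives a conjugate of the produced `Π^temp_{𝔊,b}`:
  `C(ι H) ⊓ C(ι L) = g · Π^temp_{𝔊,b} · g⁻¹` (one conjugacy class of edge-like subgroups per edge + the flag
  lemma) — this answers the loop-edge design point of the row (an unmatched `R'.Hb b` "in the position of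
  the other branch" still produces a conjugate);
* `ArithChartAction.exists_arithBrGp_eq_conjSubgroupAt`, `ArithChartAction.isEdgeLike_decompositionDataOfChart_iffAt`
  (an `R`-FREE description of the edge-like subgroups) and
  **`ArithChartAction.isEdgeLike_decompositionDataOfChart_iff_isEdgeLikeAt`**: any two choices `R`, `R'` of
  representatives produce the SAME edge-like subgroups; with abc-iut-w4-d053's
  `isVerticial_decompositionDataOfChart_iff` (vertex half, unconditional) packaged as
  `ArithChartAction.isVerticial_iff_and_isEdgeLike_iff_decompositionDataOfChartAt`.

Residual inputs: the package `ArithChartAction c ι aug actV actE actB`, `CompactInVerticialAt 𝒢`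
(`compactInVerticialAt_of_finiteGraph` for finite `𝔾`), the print hypotheses `Thm37Hypotheses` / `IsGraph`,
`ι` injective (Prop 5.2 (iv)).  The statement-level transfer (`ArithMaximalCompactStatementI/II` at an
arbitrary `Rc`) is abc-iut-w4-d059's half of the row.  Nothing here takes a side on [IUTchIII] Cor. 3.12;
typed ≠ proved for the package and for Thm 5.4 itself.
-/

namespace Literature.AnabelianGeometry.SemiGraphs

namespace ProfiniteSemiGraph

open CategoryTheory Topology
open scoped Pointwise

universe u u' u''

variable {𝒢 : ProfiniteSemiGraph.{u}} {c : TemperedPiChart 𝒢} {Gtp : Type u'} [Group Gtp]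

/-! ### Folklore bookkeeping on conjugates -/

/-- `1 · K · 1⁻¹ = K`. [folklore] -/
private theorem conjSubgroup_one_eq (K : Subgroup Gtp) : conjSubgroup (1 : Gtp) K = K := by
  ext x; simp [conjSubgroup]

/-- `g · (k · K · k⁻¹) · g⁻¹ = (g k) · K · (g k)⁻¹`. [folklore] -/
private theorem conjSubgroup_conjSubgroup_eq (g k : Gtp) (K : Subgroup Gtp) :
    conjSubgroup g (conjSubgroup k K) = conjSubgroup (g * k) K := by
  rw [conjSubgroup, conjSubgroup, conjSubgroup, Subgroup.map_map]
  congr 1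
  ext x
  simp [MulAut.conj_apply, mul_assoc]

/-- Conjugation commutes with intersections. [folklore] -/
private theorem conjSubgroup_inf (g : Gtp) (K K' : Subgroup Gtp) :
    conjSubgroup g (K ⊓ K') = conjSubgroup g K ⊓ conjSubgroup g K' :=
  Subgroup.map_inf K K' _ (MulAut.conj g).injective

/-- Transport of a `Π^temp_𝔾`-conjugate through `ι`: `ι(h · L · h⁻¹) = ι(h) · ι(L) · ι(h)⁻¹`. [folklore] -/
private theorem map_map_conj_eq_conjSubgroup (ι : c.G →* Gtp) (L : Subgroup c.G) (h : c.G) :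
    (L.map (MulAut.conj h).toMonoidHom).map ι = conjSubgroup (ι h) (L.map ι) := by
  rw [conjSubgroup, Subgroup.map_map, Subgroup.map_map]
  congr 1
  ext x
  simp [MulAut.conj_apply]

/-- `x · (y · K · y⁻¹) · x⁻¹ = (x y) · K · (x y)⁻¹` inside `Π^temp_𝔾`. [folklore] -/
private theorem map_conj_map_conj' (K : Subgroup c.G) (y x : c.G) :
    (K.map (MulAut.conj y).toMonoidHom).map (MulAut.conj x).toMonoidHom =
      K.map (MulAut.conj (x * y)).toMonoidHom := by
  rw [Subgroup.map_map]
  congr 1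
  ext z
  simp [MulAut.conj_apply, mul_assoc]

/-- Conjugating by `1` does nothing. [folklore] -/
private theorem map_conj_one' (K : Subgroup c.G) : K.map (MulAut.conj (1 : c.G)).toMonoidHom = K := by
  ext x; simp

/-! ### Rigidity: commensurating an edge-like image normalises it -/

variable {PA : Type u''} [Group PA] [TopologicalSpace PA] {ι : c.G →* Gtp} {aug : Gtp →* PA}
  {actV : PA → 𝒢.graph.Vertex → 𝒢.graph.Vertex} {actE : PA → 𝒢.graph.Edge → 𝒢.graph.Edge}
  {actB : PA → 𝒢.graph.Branch → 𝒢.graph.Branch}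

/-- **An element of `Π^temp_𝔊` commensurating `ι Π^temp_{𝔾,e}` normalises it**: its conjugate is `ι` of an
edge-like subgroup (Def 5.1 (i) on the chart, clause `conj_edgeLike`) commensurable with `Π^temp_{𝔾,e}`, hence
equal to it (`eq_of_commensurable_of_mem_edgeLikeSubgroupsAt`, Thm 3.7 (iii)/(iv) at `𝒢`).  The first step of
abc-iut-w4-d040's (c2), isolated. [cite: MochizukiSemiAnbd2006, Thm 3.7 (iii) p. 41 / Def 5.1 (i) p. 62] -/
theorem ArithChartAction.conjSubgroup_map_eq_of_mem_commensurator
    (A : ArithChartAction c ι aug actV actE actB) (h : CompactInVerticialAt 𝒢)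
    (h𝒢 : 𝒢.Thm37Hypotheses) (hG : 𝒢.graph.IsGraph) (hι : Function.Injective ι)
    {e : 𝒢.graph.Edge} {L : Subgroup c.G} (hL : L ∈ edgeLikeSubgroups c e) {g : Gtp}
    (hg : g ∈ Subgroup.Commensurable.commensurator (L.map ι)) :
    conjSubgroup g (L.map ι) = L.map ι := by
  obtain ⟨L', hL', hgL'⟩ := A.conj_edgeLike g e L hL
  have hcomm : Subgroup.Commensurable L' L := by
    rw [← commensurable_map_iff_of_injective hι, ← hgL']
    exact (Subgroup.Commensurable.commensurator_mem_iff _ g).mp hg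
  rw [hgL', eq_of_commensurable_of_mem_edgeLikeSubgroupsAt h h𝒢 hG c hL' hL hcomm]

/-- Hence conjugation by an element commensurating `ι L` carries a verticial host `H ⊇ L` to (`ι` of) a
verticial host of the SAME `L` (clause `conj_verticial` + the rigidity above, `ι` injective).
[cite: MochizukiSemiAnbd2006, §5 p. 65 / Def 5.1 (i) p. 62] -/
theorem ArithChartAction.exists_verticial_ge_of_mem_commensurator
    (A : ArithChartAction c ι aug actV actE actB) (h : CompactInVerticialAt 𝒢)
    (h𝒢 : 𝒢.Thm37Hypotheses) (hG : 𝒢.graph.IsGraph) (hι : Function.Injective ι)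
    {e : 𝒢.graph.Edge} {v : 𝒢.graph.Vertex} {L H : Subgroup c.G} (hL : L ∈ edgeLikeSubgroups c e)
    (hH : H ∈ verticialSubgroups c v) (hLH : L ≤ H) {g : Gtp}
    (hg : g ∈ Subgroup.Commensurable.commensurator (L.map ι)) :
    ∃ (v' : 𝒢.graph.Vertex) (H' : Subgroup c.G), H' ∈ verticialSubgroups c v' ∧ L ≤ H' ∧
      conjSubgroup g (H.map ι) = H'.map ι := by
  obtain ⟨H', hH', hgH'⟩ := A.conj_verticial g v H hH
  refine ⟨_, H', hH', ?_, hgH'⟩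
  rw [← Subgroup.map_le_map_iff_of_injective hι, ← hgH',
    ← A.conjSubgroup_map_eq_of_mem_commensurator h h𝒢 hG hι hL hg]
  exact Subgroup.map_mono (Subgroup.map_mono hLH)

/-! ### The flag lemma -/

/-- **FLAG LEMMA.**  For an edge-like `L` and verticial hosts `H ⊇ L`, `H' ⊇ L` the flags `C(ι H') ⊓ C(ι L)` and
`C(ι H) ⊓ C(ι L)` are conjugate by an element of `C(ι L)`.  If `H' ≠ H` they are the only two verticial hosts
of the compact nontrivial `L` (Thm 3.7 (iii) at `𝒢`, "precisely two"), so `C(ι L)` permutes `{ι H, ι H'}`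
(previous lemma): either some element swaps them and conjugates one flag onto the other, or every element
normalises both `ι H` and `ι H'`, and then `C(ι L) ≤ C(ι H) ⊓ C(ι H')` makes both flags equal to `C(ι L)`.
[cite: MochizukiSemiAnbd2006, Thm 3.7 (iii) p. 41 / §5 p. 65] -/
theorem ArithChartAction.exists_conj_commensurator_inf_eq
    (A : ArithChartAction c ι aug actV actE actB) (h : CompactInVerticialAt 𝒢)
    (h𝒢 : 𝒢.Thm37Hypotheses) (hG : 𝒢.graph.IsGraph) (hι : Function.Injective ι)
    {e : 𝒢.graph.Edge} {v v' : 𝒢.graph.Vertex} {L H H' : Subgroup c.G}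
    (hL : L ∈ edgeLikeSubgroups c e) (hH : H ∈ verticialSubgroups c v)
    (hH' : H' ∈ verticialSubgroups c v') (hLH : L ≤ H) (hLH' : L ≤ H') :
    ∃ g : Gtp, g ∈ Subgroup.Commensurable.commensurator (L.map ι) ∧
      Subgroup.Commensurable.commensurator (H'.map ι) ⊓ Subgroup.Commensurable.commensurator (L.map ι) =
        conjSubgroup g (Subgroup.Commensurable.commensurator (H.map ι) ⊓
          Subgroup.Commensurable.commensurator (L.map ι)) := by
  classical
  by_cases hHH : H' = H
  · subst hHH
    exact ⟨1, one_mem _, (conjSubgroup_one_eq _).symm⟩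
  -- `L` is compact and nontrivial, in the two distinct verticial hosts `H ≠ H'`: "precisely two"
  have hLc : IsCompact (L : Set c.G) := isCompact_of_mem_edgeLikeSubgroups c hL
  have hLinf : Infinite L := infinite_of_mem_edgeLikeSubgroups verticialInjective_holds h𝒢 c hL
  have hLne : L ≠ ⊥ := by
    intro hbot
    rw [hbot] at hLinf
    exact not_finite (⊥ : Subgroup c.G)
  have honly : ∀ (v₃ : 𝒢.graph.Vertex) (H₃ : Subgroup c.G), H₃ ∈ verticialSubgroups c v₃ → L ≤ H₃ →
      H₃ = H ∨ H₃ = H' :=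
    ((h h𝒢 c L hLc).2 hLne v v' H H' hH hH' (Ne.symm hHH) hLH hLH').1
  -- the conjugate of a subgroup by `g` is the `ConjAct`-translate
  have hsmul : ∀ (g : Gtp) (K : Subgroup Gtp), ConjAct.toConjAct g • K = conjSubgroup g K := fun _ _ => rfl
  -- every `g ∈ C(ι L)` carries `ι H` to `ι H` or to `ι H'`, and `ι H'` to `ι H'` or to `ι H`
  have hperm : ∀ g ∈ Subgroup.Commensurable.commensurator (L.map ι),
      conjSubgroup g (H.map ι) = H.map ι ∨ conjSubgroup g (H.map ι) = H'.map ι := by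
    intro g hg
    obtain ⟨v₃, H₃, hH₃, hLH₃, hgH⟩ :=
      A.exists_verticial_ge_of_mem_commensurator h h𝒢 hG hι hL hH hLH hg
    rcases honly v₃ H₃ hH₃ hLH₃ with rfl | rfl
    · exact Or.inl hgH
    · exact Or.inr hgH
  have hperm' : ∀ g ∈ Subgroup.Commensurable.commensurator (L.map ι),
      conjSubgroup g (H'.map ι) = H'.map ι ∨ conjSubgroup g (H'.map ι) = H.map ι := by
    intro g hg
    obtain ⟨v₃, H₃, hH₃, hLH₃, hgH⟩ :=
      A.exists_verticial_ge_of_mem_commensurator h h𝒢 hG hι hL hH' hLH' hg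
    rcases honly v₃ H₃ hH₃ hLH₃ with rfl | rfl
    · exact Or.inr hgH
    · exact Or.inl hgH
  by_cases hswap : ∃ g ∈ Subgroup.Commensurable.commensurator (L.map ι),
      conjSubgroup g (H.map ι) = H'.map ι
  · -- the switching case: `g` conjugates the `H`-flag onto the `H'`-flag
    obtain ⟨g, hg, hgH⟩ := hswap
    refine ⟨g, hg, ?_⟩
    rw [conjSubgroup_inf, ← commensurator_conjSubgroup, ← commensurator_conjSubgroup, hgH,
      A.conjSubgroup_map_eq_of_mem_commensurator h h𝒢 hG hι hL hg]
  · -- no switching: `C(ι L)` normalises `ι H` and `ι H'`, so both flags are `C(ι L)`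
    push Not at hswap
    have h1 : Subgroup.Commensurable.commensurator (L.map ι) ≤
        Subgroup.Commensurable.commensurator (H.map ι) := by
      intro g hg
      have hfix := (hperm g hg).resolve_right (hswap g hg)
      rw [Subgroup.Commensurable.commensurator_mem_iff, hsmul, hfix]
    have h2 : Subgroup.Commensurable.commensurator (L.map ι) ≤
        Subgroup.Commensurable.commensurator (H'.map ι) := by
      intro g hg
      have hfix : conjSubgroup g (H'.map ι) = H'.map ι := by
        refine (hperm' g hg).resolve_right fun hgH => hswap g⁻¹ (inv_mem hg) ?_
        rw [← hgH, conjSubgroup_conjSubgroup_eq, inv_mul_cancel, conjSubgroup_one_eq]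
      rw [Subgroup.Commensurable.commensurator_mem_iff, hsmul, hfix]
    refine ⟨1, one_mem _, ?_⟩
    rw [conjSubgroup_one_eq, inf_eq_right.mpr h2, inf_eq_right.mpr h1]

/-! ### The produced branch groups and the edge-like notion, for any choice of representatives -/

/-- **Every (edge-like `L` of `e(b)`, verticial host `H ⊇ L` at the vertex `v` of `b`) gives a CONJUGATE of the
produced `Π^temp_{𝔊,b}`**: `C(ι H) ⊓ C(ι L) = g · Π^temp_{𝔊,b} · g⁻¹` — `L` is a `Π^temp_𝔾`-conjugate `k · Π^temp_{𝔾,b} · k⁻¹`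
of the chosen representative (one conjugacy class per edge, `exists_conj_of_mem_edgeLikeSubgroups`), `k⁻¹ · H · k`
is a verticial host of `Π^temp_{𝔾,b}` at `v`, and the flag lemma compares it with the chosen host `Π^temp_{𝔾,v}`.
This is the loop-edge design point of the row: a representative "in the position of the other branch"
still yields a conjugate. [cite: MochizukiSemiAnbd2006, §5 p. 65 / Def 5.3 (iii)] -/
theorem ArithChartAction.exists_commensurator_inf_eq_conjSubgroup_arithBrGp
    (A : ArithChartAction c ι aug actV actE actB) (h : CompactInVerticialAt 𝒢)
    (h𝒢 : 𝒢.Thm37Hypotheses) (hG : 𝒢.graph.IsGraph) (hι : Function.Injective ι)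
    (R : ChartRepresentatives c) {b : 𝒢.graph.Branch} {v : 𝒢.graph.Vertex}
    (hb : 𝒢.graph.abuts b = some v) {L H : Subgroup c.G}
    (hL : L ∈ edgeLikeSubgroups c (𝒢.graph.edgeOf b)) (hH : H ∈ verticialSubgroups c v) (hLH : L ≤ H) :
    ∃ g : Gtp, Subgroup.Commensurable.commensurator (H.map ι) ⊓
        Subgroup.Commensurable.commensurator (L.map ι) = conjSubgroup g (arithBrGp R ι b) := by
  -- `L = k · Hb b · k⁻¹`
  obtain ⟨k, rfl⟩ := exists_conj_of_mem_edgeLikeSubgroups c (R.Hb_mem b) hL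
  -- `H = k · H'' · k⁻¹` with `H'' := k⁻¹ · H · k` a verticial host of `Hb b` at `v`
  have hHeq : H = (H.map (MulAut.conj k⁻¹).toMonoidHom).map (MulAut.conj k).toMonoidHom := by
    rw [map_conj_map_conj', mul_inv_cancel, map_conj_one']
  have hH'' : H.map (MulAut.conj k⁻¹).toMonoidHom ∈ verticialSubgroups c v :=
    conj_mem_verticialSubgroups c hH k⁻¹
  have hLH'' : R.Hb b ≤ H.map (MulAut.conj k⁻¹).toMonoidHom := by
    intro x hx
    refine ⟨k * x * k⁻¹, hLH ⟨x, hx, rfl⟩, ?_⟩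
    simp [mul_assoc]
  obtain ⟨g, -, hg⟩ := A.exists_conj_commensurator_inf_eq h h𝒢 hG hι (R.Hb_mem b) (R.Hv_mem v) hH''
    (R.Hb_le b v hb) hLH''
  refine ⟨ι k * g, ?_⟩
  rw [arithBrGp_of_abuts R ι hb, arithVertGp, ← conjSubgroup_conjSubgroup_eq, ← hg, conjSubgroup_inf,
    ← commensurator_conjSubgroup, ← commensurator_conjSubgroup, ← map_map_conj_eq_conjSubgroup,
    ← map_map_conj_eq_conjSubgroup, ← hHeq]

/-- **For two choices `R`, `R'` of representatives, `Π^temp_{𝔊,b}(R')` is a `Π^temp_𝔊`-conjugate of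
`Π^temp_{𝔊,b}(R)`** (graph of anabelioids: `b` abuts). [cite: MochizukiSemiAnbd2006, §5 p. 65] -/
theorem ArithChartAction.exists_arithBrGp_eq_conjSubgroupAt
    (A : ArithChartAction c ι aug actV actE actB) (h : CompactInVerticialAt 𝒢)
    (h𝒢 : 𝒢.Thm37Hypotheses) (hG : 𝒢.graph.IsGraph) (hι : Function.Injective ι)
    (R R' : ChartRepresentatives c) (b : 𝒢.graph.Branch) :
    ∃ g : Gtp, arithBrGp R' ι b = conjSubgroup g (arithBrGp R ι b) := by
  obtain ⟨v, hb⟩ := Option.isSome_iff_exists.mp (hG.abuts_isSome b)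
  obtain ⟨g, hg⟩ := A.exists_commensurator_inf_eq_conjSubgroup_arithBrGp h h𝒢 hG hι R hb (R'.Hb_mem b)
    (R'.Hv_mem v) (R'.Hb_le b v hb)
  exact ⟨g, by rw [arithBrGp_of_abuts R' ι hb, arithVertGp, hg]⟩

/-- One direction of the invariance: edge-like for `R'` ⇒ edge-like for `R`.
[cite: MochizukiSemiAnbd2006, Def 5.3 (iii), p. 65] -/
theorem ArithChartAction.isEdgeLike_decompositionDataOfChart_of_isEdgeLikeAt
    (A : ArithChartAction c ι aug actV actE actB) (h : CompactInVerticialAt 𝒢)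
    (h𝒢 : 𝒢.Thm37Hypotheses) (hG : 𝒢.graph.IsGraph) (hι : Function.Injective ι)
    (R R' : ChartRepresentatives c) {K : Subgroup Gtp}
    (hK : IsEdgeLike (decompositionDataOfChart R' ι) K) : IsEdgeLike (decompositionDataOfChart R ι) K := by
  obtain ⟨b, x, rfl⟩ := hK
  obtain ⟨g, hg⟩ := A.exists_arithBrGp_eq_conjSubgroupAt h h𝒢 hG hι R R' b
  refine ⟨b, x * g, ?_⟩
  change conjSubgroup x (arithBrGp R' ι b) = conjSubgroup (x * g) (arithBrGp R ι b)
  rw [hg, conjSubgroup_conjSubgroup_eq]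

/-- **Rc-INVARIANCE of the edge-like notion over the chart action** (row «T54·Rc-INVARIANCE», edge half,
WITHOUT "no switching"): any two choices `R`, `R'` of §3 representatives produce the same edge-like subgroups
(Def 5.3 (iii)) — "well-defined up to conjugation in `Π^temp_𝔊`" (p. 65) for OUR commensurator model.  Residual:
the package, Thm 3.7 (iii) at `𝒢` (`compactInVerticialAt_of_finiteGraph` for finite `𝔾`), print hypotheses,
`ι` injective. [cite: MochizukiSemiAnbd2006, Def 5.3 (iii), p. 65] -/
theorem ArithChartAction.isEdgeLike_decompositionDataOfChart_iff_isEdgeLikeAt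
    (A : ArithChartAction c ι aug actV actE actB) (h : CompactInVerticialAt 𝒢)
    (h𝒢 : 𝒢.Thm37Hypotheses) (hG : 𝒢.graph.IsGraph) (hι : Function.Injective ι)
    (R R' : ChartRepresentatives c) (K : Subgroup Gtp) :
    IsEdgeLike (decompositionDataOfChart R ι) K ↔ IsEdgeLike (decompositionDataOfChart R' ι) K :=
  ⟨A.isEdgeLike_decompositionDataOfChart_of_isEdgeLikeAt h h𝒢 hG hι R' R,
    A.isEdgeLike_decompositionDataOfChart_of_isEdgeLikeAt h h𝒢 hG hι R R'⟩

/-- **The edge-like subgroups of the produced data, `R`-free, over the chart action**: `K` is edge-like iff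
`K = g · (C(ι H) ⊓ C(ι L)) · g⁻¹` for SOME branch `b` at `v`, SOME edge-like `L` of `e(b)` and SOME verticial host
`H ⊇ L` at `v` — p. 65's "the commensurator in `Π^temp_{𝔊,v}` of `Π^temp_{𝔾,b}`" read for every admissible pair of
representatives at once. [cite: MochizukiSemiAnbd2006, Def 5.3 (iii) / §5, p. 65] -/
theorem ArithChartAction.isEdgeLike_decompositionDataOfChart_iffAt
    (A : ArithChartAction c ι aug actV actE actB) (h : CompactInVerticialAt 𝒢)
    (h𝒢 : 𝒢.Thm37Hypotheses) (hG : 𝒢.graph.IsGraph) (hι : Function.Injective ι)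
    (R : ChartRepresentatives c) (K : Subgroup Gtp) :
    IsEdgeLike (decompositionDataOfChart R ι) K ↔
      ∃ (b : 𝒢.graph.Branch) (v : 𝒢.graph.Vertex) (L H : Subgroup c.G) (g : Gtp),
        𝒢.graph.abuts b = some v ∧ L ∈ edgeLikeSubgroups c (𝒢.graph.edgeOf b) ∧
          H ∈ verticialSubgroups c v ∧ L ≤ H ∧
          K = conjSubgroup g (Subgroup.Commensurable.commensurator (H.map ι) ⊓
            Subgroup.Commensurable.commensurator (L.map ι)) := by
  constructor
  · rintro ⟨b, x, rfl⟩
    obtain ⟨v, hb⟩ := Option.isSome_iff_exists.mp (hG.abuts_isSome b)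
    refine ⟨b, v, R.Hb b, R.Hv v, x, hb, R.Hb_mem b, R.Hv_mem v, R.Hb_le b v hb, ?_⟩
    change conjSubgroup x (arithBrGp R ι b) = _
    rw [arithBrGp_of_abuts R ι hb, arithVertGp]
  · rintro ⟨b, v, L, H, x, hb, hL, hH, hLH, rfl⟩
    obtain ⟨g, hg⟩ := A.exists_commensurator_inf_eq_conjSubgroup_arithBrGp h h𝒢 hG hι R hb hL hH hLH
    refine ⟨b, x * g, ?_⟩
    change conjSubgroup x _ = conjSubgroup (x * g) (arithBrGp R ι b)
    rw [hg, conjSubgroup_conjSubgroup_eq]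

/-- Both notions of Def 5.3 (iii) for the produced data agree for any two choices of representatives, over
the chart action (vertex half: abc-iut-w4-d053's `isVerticial_decompositionDataOfChart_iff`, unconditional) —
the input of a statement-level transfer of `ArithMaximalCompactStatementI/II`.
[cite: MochizukiSemiAnbd2006, Def 5.3 (iii), p. 65] -/
theorem ArithChartAction.isVerticial_iff_and_isEdgeLike_iff_decompositionDataOfChartAt
    (A : ArithChartAction c ι aug actV actE actB) (h : CompactInVerticialAt 𝒢)
    (h𝒢 : 𝒢.Thm37Hypotheses) (hG : 𝒢.graph.IsGraph) (hι : Function.Injective ι)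
    (R R' : ChartRepresentatives c) :
    (∀ K : Subgroup Gtp,
        IsVerticial (decompositionDataOfChart R ι) K ↔ IsVerticial (decompositionDataOfChart R' ι) K) ∧
      ∀ K : Subgroup Gtp,
        IsEdgeLike (decompositionDataOfChart R ι) K ↔ IsEdgeLike (decompositionDataOfChart R' ι) K := by
  refine ⟨fun K => ?_, fun K => A.isEdgeLike_decompositionDataOfChart_iff_isEdgeLikeAt h h𝒢 hG hι R R' K⟩
  rw [isVerticial_decompositionDataOfChart_iff R ι K, isVerticial_decompositionDataOfChart_iff R' ι K]

end ProfiniteSemiGraph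

end Literature.AnabelianGeometry.SemiGraphs
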